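import Literature.NumberTheory.EllipticCurves.Fouquet2025.CongruenceTransportFromSeedMainIdentityProofs
import Literature.NumberTheory.EllipticCurves.Fouquet2025.OrdinaryCongruenceRankZeroBSDSigma
import HarnessLib

/-!
# Fouquet 2025 (Tunisian J. Math. 7), Thm 4.1 (1) ⇒ (2) with the seed mechanism of Cor. 4.3 on the
# ENLARGED prime set `Σ = primes(p·N_W·N_G)` — (A′σ): the `p`-part of BSD in analytic rank `0` for a
# target of ANY reduction at `p ≥ 5`, transported from a good-ordinary seed of ARBITRARY level whose
# cyclotomic main identity is a hypothesis; plus proved bridges (S21 ⇒ the sibling `_sigma_tate` fact is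
# a corollary; unit-value partner road in census currency)

Topic `NumberTheory/EllipticCurves`, sub-directory `Fouquet2025`. Typer seat `bsd-littype-07` (gen 2),
cross-ladder literature-typing layer (D-0088(4)). D-0064: one file for the `Σ`-enlarged reading of the
section §4.1 + proof of Cor. 4.3 (the `Σ`-variant of `CongruenceTransportFromSeedMainIdentity.lean`, in
the relation that `OrdinaryCongruenceRankZeroBSDSigma.lean` bears to `OrdinaryCongruenceRankZeroBSD.lean`).
ONE named fact (`def … : Prop`, nothing asserted, no `_holds`, size XL) and THREE proved theorems; no
definition, no instance, no notation, no `sorry`. Predicates reused: `Assumption34TateAt` (p455826),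
`Sakamoto2024.CyclotomicMainIdentityAt`.

WHY. A congruent partner `G ≡ W (mod p)` found by LEVEL RAISING (Ribet) has Steinberg primes `q ∤ N_W`
with `ρ̄` unramified at `q` (`p ∣ v_q(Δ_G)`); such `q` are supplementary primes of `Σ ⊇` primes of
`N_G`, where print's Ass. 3.4 must hold ("if `ℓ ∤ p` belongs to `Σ ∖ Σ(ρ̄)` then it is odd and one of
the following holds", [corpus:paper-arxiv-2501.07105 p0022 L43]; the paper's own §4.2.1 seed has level
`1640 ⊋ 40`, [p0029 L32]). The strict-`Σ` fact (A′) `padicValRat_bsd_rank_zero_of_congruence_of_seedMainIdentity`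
excludes such partners by its level-compatibility binder; the sibling `_sigma`/`_sigma_tate` facts admit
them but hard-wire a Skinner–Urban seed — and a level-raised partner's new Steinberg prime has `ρ̄`
UNRAMIFIED, so it never supplies S–U's (ram) hypothesis. (A′σ) below admits them with the seed's
assertion (1) as the hypothesis `Sakamoto2024.CyclotomicMainIdentityAt G p g` (any provenance; e.g. a
unit `p`-adic `L`-function via Kato's bsd.S20, `cyclotomicMainIdentityAt_of_katoDivisibility_of_norm_constantCoeff_eq_one`).

THE READING = that of (A′) (module docstring of `CongruenceTransportFromSeedMainIdentity`, (α′)(β)(γ))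
with `Σ :=` primes of `p·N_W·N_G` and `U^(p) := ∏_{ℓ≠p} K₀(ℓ^{max(v_ℓ N_W, v_ℓ N_G)})` as in the sibling
`OrdinaryCongruenceRankZeroBSDSigma` (reading (β) there, referee-read): both `f_W` and `g` are motivic
points of `T^Σ_𝔪ρ̄` (§2.4.1 p0015); at `p ≥ 5` the primes of `Σ ∖ Σ(ρ̄) ∖ {p}` are exactly the
multiplicative primes `q` of `W` or of `G` at which `ρ̄ ≅ W[p] ≅ G[p]` is unramified (an additive prime of
either curve has `ρ̄` ramified), i.e. `p ∣ v_q(Δ_min)` of the curve multiplicative at `q` (Tate), and the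
Iwahori-level case analysis of Ass. 3.4 there is `Assumption34TateAt p W` ∧ `Assumption34TateAt p G`
(asked of both curves: WEAKER than print, never stronger). No level-compatibility binder.

HONEST FRAMING. Net debt +1 by design (typing layer). WEAKER than print in every binder (surjectivity
for "contains `SL₂(𝔽_p)`"; a good-ordinary elliptic seed with (1) in Conj. 17.6 form; `Σ` = primes of
`p N_W N_G` only; `p ≥ 5`; `Finite W.sha`). Not claimed: `p ≤ 3`; non-elliptic / non-ordinary seeds;
arbitrary finite `Σ` (TODO(general form): a third auxiliary set of supplementary primes dividing neither
conductor is print-admissible but has no consumer). The sibling fact `_sigma_tate` (seed = S–U curve,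
target additive at `p`) is a COROLLARY of (A′σ) ∧ bsd.S21 ∧ modularity (`sigmaTate_of_seedMainIdentitySigma`).

## References
* [Fouquet2025EquivariantTNC] O. Fouquet, Tunisian J. Math. 7 (2025) = arXiv:2501.07105: Thm 4.1
  (pp. 24–25), proof of Cor. 4.3 first half (p. 26), §2.4.1 (p. 15), Ass. 3.4 (pp. 22–23), §4.2 (pp. 28–30),
  Thm 1.7 (2) (p. 7), §2.2 (p. 12).
* [Kato2004Asterisque] §17.13 (pp. 279–280), Conj. 12.10 (p. 224), Thm 17.4 (p. 273). [SkinnerUrban2014] Thm 3.6.9.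
* Tree: `Fouquet2025/CongruenceTransportFromSeedMainIdentity{,Proofs}.lean` (p466456, p467157),
  `Fouquet2025/OrdinaryCongruenceRankZeroBSDSigma.lean` (`_sigma`, `_sigma_tate`),
  `Fouquet2025/CongruenceTransportAnyReduction.lean` (`Assumption34TateAt`).
-/

noncomputable section

open scoped Classical MatrixGroups ModularForm

namespace Literature.NumberTheory.EllipticCurves.Fouquet2025

open WeierstrassCurve CongruenceSubgroup Literature.NumberTheory.EllipticCurves.ModularForms

/-- **Fouquet 2025, Thm 4.1 (1) ⇒ (2) and Thm 1.7 (2) on elliptic motivic points over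
`Σ = primes(p·N_W·N_G)`, assertion (1) at the SEED supplied as a hypothesis — the `p`-part of BSD in
analytic rank `0` for `W/ℚ` of ARBITRARY reduction at `p ≥ 5`, transported from a congruent
good-ordinary `G` of ARBITRARY level for which the integral cyclotomic main identity holds; ONE composite
reading (module docstring), nothing asserted, no `_holds` (size XL).** Binders: as the strict-`Σ` fact
`padicValRat_bsd_rank_zero_of_congruence_of_seedMainIdentity`, except that the level-compatibility
binder ("every bad prime `q ≠ p` of `G` divides `N_W`") is REPLACED by Ass. 3.4 in Tate form on the
unramified multiplicative primes of the seed, `Assumption34TateAt p G` (the level-raising primes of `G`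
relative to `W` are among them) — exactly as the sibling `_sigma`/`_sigma_tate` facts enlarge the
sibling `OrdinaryCongruenceRankZeroBSD` fact. WEAKER THAN PRINT in every binder; never stronger.
[cite: Fouquet2025EquivariantTNC, Thm 4.1 (1)⇒(2) (pp. 24–25), Thm 1.7 (2) (p. 7), proof of Cor. 4.3 first half (p. 26), §2.4.1 (p. 15), Ass. 3.4 (pp. 22–23), §2.2 (p. 12)]
[cite: Kato2004Asterisque, §17.13 (pp. 279–280), Conj. 12.10 (p. 224), (12.5.2) (p. 222)] -/
def padicValRat_bsd_rank_zero_of_congruence_of_seedMainIdentity_sigma : Prop :=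
  ∀ (W G : WeierstrassCurve ℚ) [W.IsElliptic] [W.IsGloballyMinimal] [G.IsElliptic] [G.IsGloballyMinimal]
    (p : ℕ) [Fact p.Prime], 5 ≤ p →
    -- Ass. 2.9 (1): `ρ̄_{W,p}` onto `GL₂(𝔽_p)`
    W.HasSurjectiveModNGaloisRep p →
    -- Ass. 2.9 (2): the `p`-division polynomial of `W` has no root in `ℚ_p`
    (∀ x : ℚ_[p], ((W.baseChange ℚ_[p]).ΨSq (p : ℤ)).eval x ≠ 0) →
    -- Ass. 3.4 on the unramified Steinberg primes of `W` (Tate form)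
    Assumption34TateAt p W →
    -- the seed `λ_G`: good ordinary at `p`, `G[p]` irreducible, `ρ_{G,p^∞}` onto, a newform `g`, its identity
    G.HasGoodReductionAtPrime p → ¬ (p : ℤ) ∣ G.frobeniusTrace p →
    G.HasIrreducibleModPGaloisRep p →
    (∀ n : ℕ, G.HasSurjectiveModNGaloisRep (p ^ n : ℕ)) →
    ∀ {M : ℕ} [NeZero M] (g : CuspForm (Gamma0 M) 2), IsNewformOf G g →
    Sakamoto2024.CyclotomicMainIdentityAt G p g →
    -- `a_ℓ(W) ≡ a_ℓ(G) (mod p)` off `p N_W N_G`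
    (∀ ℓ : ℕ, ℓ.Prime → ¬ (ℓ ∣ p * W.conductorNorm ℤ * G.conductorNorm ℤ) →
      ((W.LFunction ℓ : ℤ) : ZMod p) = ((G.LFunction ℓ : ℤ) : ZMod p)) →
    -- Ass. 3.4 on the unramified Steinberg primes of `G` (Tate form; covers the level-raising primes)
    Assumption34TateAt p G →
    -- analytic rank 0, `Ш(W)` finite
    W.entireLFunction 1 ≠ 0 → Finite W.sha →
    ∃ q : ℚ, W.entireLFunction 1 / (W.realPeriodRat : ℂ) = (q : ℂ) ∧
      padicValRat p q = (padicValNat p W.shaOrder : ℤ) + padicValNat p W.tamagawaProduct -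
        2 * padicValNat p W.torsionOrder

/-- **(A′σ) ∧ bsd.S21 ∧ modularity ⇒ the sibling fact `_sigma_tate`** (seed = a Skinner–Urban curve,
target additive at `p`): a COROLLARY, the seed's identity being `cyclotomicMainIdentityAt_of_skinnerUrban`.
[cite: Fouquet2025EquivariantTNC, Thm 4.1 (1)⇒(2) (pp. 24–25)] [cite: SkinnerUrban2014, Thm 3.6.9 (p. 45)] -/
theorem sigmaTate_of_seedMainIdentitySigma
    (hA : padicValRat_bsd_rank_zero_of_congruence_of_seedMainIdentity_sigma)
    (hSU : ∀ (G : WeierstrassCurve ℚ) [G.IsElliptic] [G.IsGloballyMinimal] (p : ℕ) [Fact p.Prime]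
      (κ : ZpExtension ℚ p) (γ : Field.absoluteGaloisGroup ℚ) (N : ℕ) [NeZero N]
      (g : CuspForm (Gamma0 N) 2), skinner_urban_main_conjecture G p (κ := κ) (γ := γ) (f := g))
    (hmod : exists_isNewformOf) :
    padicValRat_bsd_rank_zero_of_ordinaryCongruence_sigma_tate := by
  intro W G _ _ _ _ p _ hp _hadd₁ _hadd₂ hsurj hΨ h34W hGgood hGord hGirr hGaux hGbig hcong h34G hL hsha
  haveI : NeZero (G.conductorNorm ℤ) := ⟨(G.conductorNorm_pos_holds).ne'⟩
  obtain ⟨g, hg⟩ := hmod G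
  have hid : Sakamoto2024.CyclotomicMainIdentityAt G p g :=
    cyclotomicMainIdentityAt_of_skinnerUrban G p (hSU G p) (by omega) hGgood hGord hGirr hGaux
      hGbig g hg
  exact hA W G p hp hsurj hΨ h34W hGgood hGord hGirr hGbig g hg hid hcong h34G hL hsha

/-- **(A′σ) ⇒ (A′)-with-both-Tate-clauses:** when every bad prime `q ≠ p` of `G` divides `N_W` the
`Σ`-enlarged fact specialises to the strict-`Σ` situation, at the price of asking `Assumption34TateAt p G`
as well (the kernel cannot identify the two curves' Tate clauses at a shared prime without Tate
uniformisation). Bookkeeping only. [cite: Fouquet2025EquivariantTNC, Thm 4.1 (1)⇒(2) (pp. 24–25)] -/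
theorem strict_of_seedMainIdentitySigma
    (hA : padicValRat_bsd_rank_zero_of_congruence_of_seedMainIdentity_sigma)
    (W G : WeierstrassCurve ℚ) [W.IsElliptic] [W.IsGloballyMinimal] [G.IsElliptic] [G.IsGloballyMinimal]
    (p : ℕ) [Fact p.Prime] (hp : 5 ≤ p) (hsurj : W.HasSurjectiveModNGaloisRep p)
    (hΨ : ∀ x : ℚ_[p], ((W.baseChange ℚ_[p]).ΨSq (p : ℤ)).eval x ≠ 0)
    (h34W : Assumption34TateAt p W) (h34G : Assumption34TateAt p G)
    (hGgood : G.HasGoodReductionAtPrime p) (hGord : ¬ (p : ℤ) ∣ G.frobeniusTrace p)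
    (hGirr : G.HasIrreducibleModPGaloisRep p) (hGbig : ∀ n : ℕ, G.HasSurjectiveModNGaloisRep (p ^ n : ℕ))
    {M : ℕ} [NeZero M] (g : CuspForm (Gamma0 M) 2) (hg : IsNewformOf G g)
    (hid : Sakamoto2024.CyclotomicMainIdentityAt G p g)
    (hcong : ∀ ℓ : ℕ, ℓ.Prime → ¬ (ℓ ∣ p * W.conductorNorm ℤ * G.conductorNorm ℤ) →
      ((W.LFunction ℓ : ℤ) : ZMod p) = ((G.LFunction ℓ : ℤ) : ZMod p))
    (hL : W.entireLFunction 1 ≠ 0) (hsha : Finite W.sha) :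
    ∃ q : ℚ, W.entireLFunction 1 / (W.realPeriodRat : ℂ) = (q : ℂ) ∧
      padicValRat p q = (padicValNat p W.shaOrder : ℤ) + padicValNat p W.tamagawaProduct -
        2 * padicValNat p W.torsionOrder :=
  hA W G p hp hsurj hΨ h34W hGgood hGord hGirr hGbig g hg hid hcong h34G hL hsha

/-- **The turnkey rank-0 road over `Σ = primes(p·N_W·N_G)` in census currency** (level-raised
unit-value partners allowed). Granting (A′σ) and Kato's bsd.S20 for the partner: target `W` (any
reduction at `p ≥ 5`; surjective `ρ̄_{W,p}`; `ΨSq_p` rootless over `ℚ_p`; `Assumption34TateAt p W`;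
`L(W,1) ≠ 0`, `Ш(W)` finite), partner `G` good ordinary at `p` with `G[p]` irreducible, `ρ_{G,p^n}` onto
for all `n`, `Assumption34TateAt p G`, a newform `g` with `p ∤ a_p(G) − 1`, `[0]⁺_g = L(G,1)/Ω⁺_g ≠ 0` and
`v_p([0]⁺_g) = 0`, congruent to `W` off `p·N_W·N_G` ⟹ the `p`-part of BSD for `W` in analytic rank
`0`. No ramified Steinberg prime on either curve; no level compatibility.
[cite: Fouquet2025EquivariantTNC, Thm 4.1 (1)⇒(2) (pp. 24–25), proof of Cor. 4.3 first half (p. 26), §4.2 (pp. 28–30)] [cite: Kato2004Asterisque, Thm 17.4 (3) (p. 273)] [cite: MazurTateTeitelbaum1986Invent, §I.14 (14.3)] -/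
theorem padicValRat_bsd_rank_zero_of_congruence_of_unitValueSeed_sigma
    (hA : padicValRat_bsd_rank_zero_of_congruence_of_seedMainIdentity_sigma)
    (W G : WeierstrassCurve ℚ) [W.IsElliptic] [W.IsGloballyMinimal] [G.IsElliptic] [G.IsGloballyMinimal]
    (p : ℕ) [Fact p.Prime] (hp : 5 ≤ p)
    (hKato : ∀ (κ : ZpExtension ℚ p) (γ : Field.absoluteGaloisGroup ℚ) (N : ℕ) [NeZero N]
      (g : CuspForm (Gamma0 N) 2), kato_divisibility G p (κ := κ) (γ := γ) (f := g))
    (hsurj : W.HasSurjectiveModNGaloisRep p)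
    (hΨ : ∀ x : ℚ_[p], ((W.baseChange ℚ_[p]).ΨSq (p : ℤ)).eval x ≠ 0)
    (h34W : Assumption34TateAt p W) (h34G : Assumption34TateAt p G)
    (hGgood : G.HasGoodReductionAtPrime p) (hGord : ¬ (p : ℤ) ∣ G.frobeniusTrace p)
    (hGirr : G.HasIrreducibleModPGaloisRep p) (hGbig : ∀ n : ℕ, G.HasSurjectiveModNGaloisRep (p ^ n : ℕ))
    {M : ℕ} [NeZero M] (g : CuspForm (Gamma0 M) 2) (hg : IsNewformOf G g)
    (hap : ¬ (p : ℤ) ∣ G.frobeniusTrace p - 1)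
    (hL0 : ratPlusSymbol g 0 ≠ 0) (hval : padicValRat p (ratPlusSymbol g 0) = 0)
    (hcong : ∀ ℓ : ℕ, ℓ.Prime → ¬ (ℓ ∣ p * W.conductorNorm ℤ * G.conductorNorm ℤ) →
      ((W.LFunction ℓ : ℤ) : ZMod p) = ((G.LFunction ℓ : ℤ) : ZMod p))
    (hL : W.entireLFunction 1 ≠ 0) (hsha : Finite W.sha) :
    ∃ q : ℚ, W.entireLFunction 1 / (W.realPeriodRat : ℂ) = (q : ℂ) ∧
      padicValRat p q = (padicValNat p W.shaOrder : ℤ) + padicValNat p W.tamagawaProduct -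
        2 * padicValNat p W.torsionOrder := by
  have hid : Sakamoto2024.CyclotomicMainIdentityAt G p g :=
    cyclotomicMainIdentityAt_of_katoDivisibility_of_norm_constantCoeff_eq_one G p hKato (by omega)
      ⟨hGgood, hGord⟩ hGbig g hg
      (norm_constantCoeff_padicLFunction_eq_one_of_padicValRat_eq_zero G p ⟨hGgood, hGord⟩ g hg hap hL0 hval)
  exact hA W G p hp hsurj hΨ h34W hGgood hGord hGirr hGbig g hg hid hcong h34G hL hsha

end Literature.NumberTheory.EllipticCurves.Fouquet2025

end

/-! ## ADDENDUM — PROVENANCE OF THM 2.10 INSIDE THM 4.1 (typer bsd-littype-07 gen 2, 2026-08-26; docstring only,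
## no declaration changed; verbatim the dichotomy of the sibling `OrdinaryCongruenceRankZeroBSD.lean` ADDENDUM of seat
## bsd-potss-k8t-c2 g5)
Every named fact of this file transcribes Fouquet's Thm 4.1 (1) ⇒ (2) under his PRINTED hypotheses (Ass. 2.9, Ass. 3.4).
Thm 4.1's input Thm 2.10 (the zeta morphism for `T_Σ`, p. 15) is attributed by Fouquet to «K. Nakamura and independently
P. Colmez and S. Wang». Nakamura's PUBLISHED theorem (Invent. Math. 234 (2023) Thm 1.1) carries the local hypothesis (4)
`ρ̄_p ≇ (1 ∗; 0 ε̄^{±1}) ⊗ χ`, ONE SIGN STRONGER than Ass. 2.9 (2), which coincides with the «générique» hypothesis of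
Colmez–Wang, arXiv:2104.09200 — a PREPRINT. Here `ρ̄ = W[p] ≅ G[p]` with `G` a good-ORDINARY seed
(`ρ̄_p ≅ (ωδ⁻¹ ∗; 0 δ)`, `δ(Frob_p) ≡ a_p(G)`), so hypothesis (4) fails iff `a_p(G)² ≡ 1 (mod p)`: on such rows the chain
behind these facts has a preprint input (Colmez–Wang) as far as the seats could determine — referee flag suffix
`@Fouquet-2.10-via-ColmezWang-PRE` —, while for `a_p(G)² ≢ 1 (mod p)` every input is refereed (Nakamura 2023; the
pattern of the sibling `padicValRat_bsd_rank_zero_of_ordinaryCongruence_nakamura`, whose extra binder is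
`¬ (p : ℤ) ∣ a_p(G)² − 1`). Consumers who need a preprint-free chain add that binder on the seed. Nothing declared above
changed. [cite: Fouquet2025EquivariantTNC, Thm 2.10 (p. 15)] -/
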